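import Summits.HubbardSuperconductivity.HubbardSuperconductivity.Theorems.TwSourcedInertness.Negative.FreeGain
import Literature.MathematicalPhysics.QuantumLattice.GibbsEntropy
import Literature.MathematicalPhysics.QuantumLattice.TorusCooperSum

/-!
# Crux `TwSourcedInertness` (item `stmt-HubbardSuperconductivity-1696`): in the lead's two stubs the
# finite-size threshold `L₀` is load-bearing (refuted uniform-threshold variants)

The lead's skeleton (`e54a28ee`) registered two stubs: `stub_thermalDisc` (the crux restricted to the
thermal disc `|h| ≤ 1/β`) and `stub_entropyDensity` (`log Z + β⟨H⟩ ≤ C L²/β` for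
`H = hubbardTorusWith 2 L 1 U μ`). Both are true thermodynamic-limit statements AS STATED (with
`∃ L₀ = L₀(U,β,μ)`). This file proves that in both the threshold cannot be chosen before `β`
(statements inlined verbatim, no named `Prop`):

* `stub_thermalDisc_false_uniformL0`, `stub_thermalDisc_false_allL` — witness `μ = −1`, `L = 3j`,
  zero mode `q = (j,0)`, `h = 1/β`, `β = (4CL²+1)²`, `U = min(U₀, a/(1+log β), 1/(4βL²))`: the free
  zero-mode gain `F(3√2)/(βL²) ≥ 1/(βL²)` beats `C(1+log β)/β² + 2U`; so `L₀(β,−1)² ≳ β/(C(1+log β))`;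
* `log_partitionFn_free` (`log Z_L(β,μ,0) = 2L² log 2 + Σ_k[−βξ_k + F(βξ_k)]`),
  `two_log_two_le_dyadic_free`, `entropy_lower_bound_of_level` (`S_L(β) ≥ 2 log 2 − 4β|U|L²` on a
  torus with a free level at `μ`: dyadic sandwich `S(β) ≥ 2 log Z(β) − log Z(2β)` of the tree's
  `GibbsEntropy` + exact free `Z` + `‖U W‖ ≤ |U|L²`);
* `stub_entropyDensity_false_uniformL0`, `stub_entropyDensity_false_allL` — same torus,
  `β = 2CL² + 2`: `S_L(β) ≥ log 2 > CL²/β`; so `L₀(β,−1)² ≳ β/C` (each exact zero mode keeps entropy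
  `2 log 2` down to `T = 0`).

Sources: folklore (Gibbs variational sandwich; Bratteli–Robinson II §5.3); tree `GibbsEntropy`,
`DWaveSourceFreePressure`; sibling `FreeGain`.
-/

noncomputable section

namespace Summit.HubbardSuperconductivity.HubbardSuperconductivity.Theorems.TwSourcedInertness.Negative

open Matrix Finset Literature.MathematicalPhysics.QuantumLattice Literature.Probability.LatticeModels

/-! ## The lead's registered stubs (skeleton `e54a28ee`): `L₀` is load-bearing in both

* `stub_thermalDisc`     = the crux restricted to the thermal disc `|h| ≤ 1/β` (linear-response
  regime); together with `stub_entropyDensity` it implies the crux by the temperature-for-source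
  staircase (`Theorems/ThermalWedgeTwSourcedInertnessLadder.lean`).
* `stub_entropyDensity`  = `S_L(β) := log Z + β⟨H⟩ ≤ C L²/β` (entropy density `≤ C·T`) for
  `H = hubbardTorusWith 2 L 1 U μ`, `1 ≤ β ≤ e^{a/U}`, eventually in `L`.

VERDICT: both stubs SURVIVE as stated (they carry `∃ L₀(U,β,μ)`, i.e. they are thermodynamic-limit
Fermi-liquid statements: `χ_d ≲ ρ_d log β`, `s ≲ γT`). What is proved below is that in BOTH the
threshold `L₀` is load-bearing and must grow with `β` — exactly as for the crux (work file §D), by a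
two-line argument from the exact free formula:
`stub_thermalDisc_false_uniformL0`, `stub_entropyDensity_false_uniformL0` (and the `∀ L ≥ 3`
corollaries). Quantitatively, at `μ = −1` on the `3j`-tori: the thermal-disc bound needs
`L₀(β)² ≳ β/(C(1+log β))` (zero-mode Curie term `F(3√2)/(βL²)` at `h = 1/β`), the entropy bound
needs `L₀(β)² ≳ β/C` (each exact zero mode carries entropy `2 log 2` down to `T = 0`). -/

section Targets

variable (L : ℕ) [NeZero L]

/-! ### I.1 `stub_thermalDisc` -/

/-- The `∀ L ≥ 3` variant of `stub_thermalDisc` implies its uniform-threshold variant (`L₀ = 3`). [folklore] -/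
theorem stubThermalDiscUniformL0_of_allL (H : ∀ μ₁ μ₂ : ℝ, -4 < μ₁ → μ₁ ≤ μ₂ → μ₂ < 0 → ∃ U₀ a C : ℝ, 0 < U₀ ∧ 0 < a ∧ 0 < C ∧ 
    ∀ U : ℝ, 0 < U →
    U ≤ U₀ → ∀ β : ℝ, 1 ≤ β → β ≤ Real.exp (a / U) → ∀ μ ∈ Set.Icc μ₁ μ₂, 
      ∀ (L : ℕ) [NeZero L], 3 ≤ L → ∀ h : ℝ, |h| ≤ 1 / β →
        (Real.log (Matrix.partitionFn β (dWaveSourceTorus L U μ h)).re / (β * (L : ℝ) ^ 2)) -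
          (Real.log (Matrix.partitionFn β (dWaveSourceTorus L U μ 0)).re / (β * (L : ℝ) ^ 2)) ≤
          C * (1 + Real.log β) * h ^ 2) :
    ∀ μ₁ μ₂ : ℝ, -4 < μ₁ → μ₁ ≤ μ₂ → μ₂ < 0 → ∃ U₀ a C : ℝ, 0 < U₀ ∧ 0 < a ∧ 0 < C ∧ ∃ L₀ : ℕ,
    ∀ U : ℝ, 0 < U →
    U ≤ U₀ → ∀ β : ℝ, 1 ≤ β → β ≤ Real.exp (a / U) → ∀ μ ∈ Set.Icc μ₁ μ₂, 
      ∀ (L : ℕ) [NeZero L], L₀ ≤ L → ∀ h : ℝ, |h| ≤ 1 / β →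
        (Real.log (Matrix.partitionFn β (dWaveSourceTorus L U μ h)).re / (β * (L : ℝ) ^ 2)) -
          (Real.log (Matrix.partitionFn β (dWaveSourceTorus L U μ 0)).re / (β * (L : ℝ) ^ 2)) ≤
          C * (1 + Real.log β) * h ^ 2 := by
  intro μ₁ μ₂ h1 h2 h3
  obtain ⟨U₀, a, C, hU₀, ha, hC, hmain⟩ := H μ₁ μ₂ h1 h2 h3
  exact ⟨U₀, a, C, hU₀, ha, hC, 3, hmain⟩

/-- **The thermal-disc contradiction on one torus carrying the level `−1`.** -/
theorem no_disc_bound_on_torus_with_level (hL3 : 3 ≤ L) (q : TorusSite 2 L)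
    (hq : torusBand L q = -1) (hg : dWaveGap q = -3 / 2) {U₀ a C : ℝ} (hU₀ : 0 < U₀) (ha : 0 < a)
    (hC : 0 < C)
    (hmain : ∀ U : ℝ, 0 < U → U ≤ U₀ → ∀ β : ℝ, 1 ≤ β → β ≤ Real.exp (a / U) → ∀ h : ℝ,
      |h| ≤ 1 / β →
      (Real.log (partitionFn β (dWaveSourceTorus L U (-1) h)).re / (β * (L : ℝ) ^ 2)) - (Real.log (partitionFn β (dWaveSourceTorus L U (-1) 0)).re / (β * (L : ℝ) ^ 2)) ≤ C * (1 + Real.log β) * h ^ 2) :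
    False := by
  have hLpos : (0 : ℝ) < (L : ℝ) := by exact_mod_cast Nat.pos_of_ne_zero (NeZero.ne L)
  set M : ℝ := (L : ℝ) ^ 2 with hM
  have hMpos : 0 < M := by positivity
  -- β = t², t = 4 C L² + 1
  have h4CM : 0 < 4 * C * M := by positivity
  set t : ℝ := 4 * C * M + 1 with ht
  have ht1 : 1 ≤ t := by linarith
  have ht0 : 0 < t := by linarith
  set β : ℝ := t ^ 2 with hβdef
  have hβ1 : 1 ≤ β := by rw [hβdef]; nlinarith
  have hβpos : 0 < β := by linarith
  have hlog0 : 0 ≤ Real.log β := Real.log_nonneg hβ1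
  have hlog : 1 + Real.log β ≤ 2 * t := one_add_log_sq_le ht1
  -- U
  set U : ℝ := min U₀ (min (a / (1 + Real.log β)) (1 / (4 * β * M))) with hUdef
  have hUpos : 0 < U := lt_min hU₀ (lt_min (div_pos ha (by linarith)) (by positivity))
  have hUU₀ : U ≤ U₀ := min_le_left _ _
  have hUa : U ≤ a / (1 + Real.log β) := (min_le_right _ _).trans (min_le_left _ _)
  have hUq : U ≤ 1 / (4 * β * M) := (min_le_right _ _).trans (min_le_right _ _)
  have hβexp : β ≤ Real.exp (a / U) := le_exp_div_of_le hUpos hβ1 hUa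
  -- the stub at h = 1/β
  have hh : |1 / β| ≤ 1 / β := by rw [abs_of_pos (by positivity)]
  have hup := hmain U hUpos hUU₀ β hβ1 hβexp (1 / β) hh
  -- the zero-mode lower bound
  have hlow := level_gain_lower_bound L hL3 hβpos hq U (1 / β)
  have harg : β * |2 * Real.sqrt 2 * (1 / β) * dWaveGap q| = 3 * Real.sqrt 2 := by
    rw [hg, show 2 * Real.sqrt 2 * (1 / β) * (-3 / 2 : ℝ) = -(3 * Real.sqrt 2 / β) by ring, abs_neg,
      abs_of_pos (by positivity)]
    field_simp
  rw [harg, abs_of_pos hUpos] at hlow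
  have hF := one_le_bdgF_three_sqrt_two
  -- 1/(βM) - 2U ≤ C (1 + log β)/β²
  have hβM : 0 < β * M := by positivity
  have h1 : 1 / (β * M) ≤ Real.log ((1 + Real.cosh (3 * Real.sqrt 2)) / 2) / (β * M) :=
    div_le_div_of_nonneg_right hF hβM.le
  have h2U : 2 * U ≤ 1 / (2 * (β * M)) := by
    calc 2 * U ≤ 2 * (1 / (4 * β * M)) := by linarith
      _ = 1 / (2 * (β * M)) := by field_simp; ring
  have hchain : 1 / (2 * (β * M)) ≤ C * (1 + Real.log β) * (1 / β) ^ 2 := by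
    have : 1 / (β * M) - 1 / (2 * (β * M)) = 1 / (2 * (β * M)) := by field_simp; ring
    linarith
  -- hence β ≤ 2 C M (1 + log β) ≤ 4 C M t < t² = β
  have hineq : β ≤ 2 * C * M * (1 + Real.log β) := by
    rw [div_le_iff₀ (by positivity)] at hchain
    have e : C * (1 + Real.log β) * (1 / β) ^ 2 * (2 * (β * M)) =
        2 * C * M * (1 + Real.log β) / β := by field_simp
    rw [e, le_div_iff₀ hβpos] at hchain
    nlinarith
  have hlt : 2 * C * M * (1 + Real.log β) < β := by
    calc 2 * C * M * (1 + Real.log β) ≤ 2 * C * M * (2 * t) := by gcongr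
      _ = (4 * C * M) * t := by ring
      _ < t * t := by apply mul_lt_mul_of_pos_right _ ht0; linarith
      _ = β := by rw [hβdef, sq]
  linarith

/-- **TARGET `stub_thermalDisc`: no finite-size threshold uniform in `β`.**
(uniform-threshold variant refuted) — witness `μ₁ = μ₂ = −1`, `L = 3·max(L₀,1)`, the exact zero mode
`q = (L/3, 0)` (`ε = −1`, `ĝ_d = −3/2`), `h = 1/β`, `β = (4CL² + 1)²`,
`U = min(U₀, a/(1+log β), 1/(4βL²))`: the free zero-mode gain `F(3√2)/(βL²) ≥ 1/(βL²)` beats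
`C(1+log β)/β² + 2U`. MESSAGE: in the linear-response regime too, `L₀(β, −1)² ≳ β/(C(1+log β))`. -/
theorem stub_thermalDisc_false_uniformL0 : ¬ (∀ μ₁ μ₂ : ℝ, -4 < μ₁ → μ₁ ≤ μ₂ → μ₂ < 0 → ∃ U₀ a C : ℝ, 0 < U₀ ∧ 0 < a ∧ 0 < C ∧ ∃ L₀ : ℕ,
    ∀ U : ℝ, 0 < U →
    U ≤ U₀ → ∀ β : ℝ, 1 ≤ β → β ≤ Real.exp (a / U) → ∀ μ ∈ Set.Icc μ₁ μ₂, 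
      ∀ (L : ℕ) [NeZero L], L₀ ≤ L → ∀ h : ℝ, |h| ≤ 1 / β →
        (Real.log (Matrix.partitionFn β (dWaveSourceTorus L U μ h)).re / (β * (L : ℝ) ^ 2)) -
          (Real.log (Matrix.partitionFn β (dWaveSourceTorus L U μ 0)).re / (β * (L : ℝ) ^ 2)) ≤
          C * (1 + Real.log β) * h ^ 2) := by
  intro H
  obtain ⟨U₀, a, C, hU₀, ha, hC, L₀, hmain⟩ := H (-1) (-1) (by norm_num) le_rfl (by norm_num)
  set j : ℕ := max L₀ 1 with hjdef
  have hj : 1 ≤ j := le_max_right _ _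
  have hjL : L₀ ≤ j := le_max_left _ _
  haveI : NeZero (3 * j) := ⟨by omega⟩
  have hL3 : 3 ≤ 3 * j := by omega
  have hL₀ : L₀ ≤ 3 * j := by omega
  exact no_disc_bound_on_torus_with_level (3 * j) hL3 ((![((j : ℕ) : ZMod (3 * j)), 0] : TorusSite 2 (3 * j))) (torusBand_qOn hj) (dWaveGap_qOn hj)
    hU₀ ha hC (fun U hU hUU β hβ hβa h hh => hmain U hU hUU β hβ hβa (-1) ⟨le_rfl, le_rfl⟩ (3 * j)
      hL₀ h hh)

/-- Corollary: the `∀ L ≥ 3` variant of `stub_thermalDisc` is false. -/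
theorem stub_thermalDisc_false_allL : ¬ (∀ μ₁ μ₂ : ℝ, -4 < μ₁ → μ₁ ≤ μ₂ → μ₂ < 0 → ∃ U₀ a C : ℝ, 0 < U₀ ∧ 0 < a ∧ 0 < C ∧ 
    ∀ U : ℝ, 0 < U →
    U ≤ U₀ → ∀ β : ℝ, 1 ≤ β → β ≤ Real.exp (a / U) → ∀ μ ∈ Set.Icc μ₁ μ₂, 
      ∀ (L : ℕ) [NeZero L], 3 ≤ L → ∀ h : ℝ, |h| ≤ 1 / β →
        (Real.log (Matrix.partitionFn β (dWaveSourceTorus L U μ h)).re / (β * (L : ℝ) ^ 2)) -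
          (Real.log (Matrix.partitionFn β (dWaveSourceTorus L U μ 0)).re / (β * (L : ℝ) ^ 2)) ≤
          C * (1 + Real.log β) * h ^ 2) :=
  fun H => stub_thermalDisc_false_uniformL0 (stubThermalDiscUniformL0_of_allL H)

/-! ### I.2 `stub_entropyDensity` -/

omit [NeZero L] in
/-- The stub's left-hand side is the tree's `Matrix.gibbsEntropy`. -/
theorem stubEntropyDensity_lhs_eq (β U μ : ℝ) :
    Real.log (Matrix.partitionFn β (hubbardTorusWith 2 L 1 U μ)).re +
        β * (Matrix.gibbsState β (hubbardTorusWith 2 L 1 U μ) (hubbardTorusWith 2 L 1 U μ)).re =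
      gibbsEntropy β (hubbardTorusWith 2 L 1 U μ) := rfl

/-- The `∀ L ≥ 3` variant of `stub_entropyDensity` implies its uniform-threshold variant (`L₀ = 3`). [folklore] -/
theorem stubEntropyDensityUniformL0_of_allL (H : ∀ μ₁ μ₂ : ℝ, -4 < μ₁ → μ₁ ≤ μ₂ → μ₂ < 0 → ∃ U₀ a C : ℝ, 0 < U₀ ∧ 0 < a ∧ 0 < C ∧ 
    ∀ U : ℝ, 0 < U →
    U ≤ U₀ → ∀ β : ℝ, 1 ≤ β → β ≤ Real.exp (a / U) → ∀ μ ∈ Set.Icc μ₁ μ₂, 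
      ∀ (L : ℕ) [NeZero L], 3 ≤ L → 
        Real.log (Matrix.partitionFn β (hubbardTorusWith 2 L 1 U μ)).re +
          β * (Matrix.gibbsState β (hubbardTorusWith 2 L 1 U μ) (hubbardTorusWith 2 L 1 U μ)).re ≤
          C * (L : ℝ) ^ 2 / β) :
    ∀ μ₁ μ₂ : ℝ, -4 < μ₁ → μ₁ ≤ μ₂ → μ₂ < 0 → ∃ U₀ a C : ℝ, 0 < U₀ ∧ 0 < a ∧ 0 < C ∧ ∃ L₀ : ℕ,
    ∀ U : ℝ, 0 < U →
    U ≤ U₀ → ∀ β : ℝ, 1 ≤ β → β ≤ Real.exp (a / U) → ∀ μ ∈ Set.Icc μ₁ μ₂, 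
      ∀ (L : ℕ) [NeZero L], L₀ ≤ L → 
        Real.log (Matrix.partitionFn β (hubbardTorusWith 2 L 1 U μ)).re +
          β * (Matrix.gibbsState β (hubbardTorusWith 2 L 1 U μ) (hubbardTorusWith 2 L 1 U μ)).re ≤
          C * (L : ℝ) ^ 2 / β := by
  intro μ₁ μ₂ h1 h2 h3
  obtain ⟨U₀, a, C, hU₀, ha, hC, hmain⟩ := H μ₁ μ₂ h1 h2 h3
  exact ⟨U₀, a, C, hU₀, ha, hC, 3, hmain⟩

/-- The per-mode factor of the unsourced free partition function:
`log(e^{−βξ}(1 + cosh(β√(ξ² + 0)))/2) = −βξ + F(βξ)`. -/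
theorem bdgF_eq_of_abs_eq {x y : ℝ} (h : |x| = |y|) : Real.log ((1 + Real.cosh x) / 2) = Real.log ((1 + Real.cosh y) / 2) := by
  rw [← bdgF_abs x, h, bdgF_abs]

omit [NeZero L] in
/-- The per-mode factor of the unsourced free partition function:
`log(e^{−βξ}(1 + cosh(β√(ξ² + 0)))/2) = −βξ + F(βξ)`. [folklore] -/
theorem log_freeModeFactor (β ξ : ℝ) (k : TorusSite 2 L) :
    Real.log (Real.exp (-(β * ξ)) *
        ((1 + Real.cosh (β * Real.sqrt (ξ ^ 2 + (2 * Real.sqrt 2 * 0 * dWaveGap k) ^ 2))) / 2)) =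
      -(β * ξ) + Real.log ((1 + Real.cosh (β * ξ)) / 2) := by
  rw [Real.log_mul (Real.exp_pos _).ne' (bdgF_arg_pos _).ne', Real.log_exp]
  congr 1
  rw [mul_zero, zero_mul, show (0:ℝ) ^ 2 = 0 by norm_num, add_zero, Real.sqrt_sq_eq_abs]
  refine bdgF_eq_of_abs_eq ?_
  rw [abs_mul, abs_abs, abs_mul]

/-- **The exact unsourced free partition function** (`L ≥ 3`):
`log Z_L(β, μ, U=0) = 2L² log 2 + Σ_k [−βξ_k + F(βξ_k)]`. -/
theorem log_partitionFn_free (hL : 3 ≤ L) (β μ : ℝ) :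
    Real.log (partitionFn β (hubbardTorusWith 2 L 1 0 μ)).re =
      2 * (L : ℝ) ^ 2 * Real.log 2 +
        ∑ k : TorusSite 2 L, (-(β * (torusBand L k - μ)) + Real.log ((1 + Real.cosh (β * (torusBand L k - μ))) / 2)) := by
  rw [← dWaveSourceTorus_zero (L := L) 0 μ, partitionFn_dWaveSourceTorus_zero_re hL β μ 0]
  have hpos : ∀ k : TorusSite 2 L, 0 < Real.exp (-(β * (torusBand L k - μ))) *
      ((1 + Real.cosh (β * Real.sqrt ((torusBand L k - μ) ^ 2 +
        (2 * Real.sqrt 2 * 0 * dWaveGap k) ^ 2))) / 2) := fun k => bdgModeFactor_pos β _ _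
  rw [Real.log_mul (by positivity) (Finset.prod_ne_zero_iff.2 fun k _ => (hpos k).ne'),
    Real.log_prod (s := Finset.univ) (hf := fun k _ => (hpos k).ne'), Real.log_pow, card_orb_fermionTorus_two]
  congr 1
  · push_cast; ring
  · exact Finset.sum_congr rfl fun k _ => log_freeModeFactor L β _ k

/-- **Dyadic entropy witness of the free gas**: `2 log Z₀(β) − log Z₀(2β) ≥ 2 log 2` on a torus
with a level at `μ` (`L ≥ 3`; every exact zero mode keeps entropy `2 log 2` at all temperatures). -/
theorem two_log_two_le_dyadic_free (hL : 3 ≤ L) (β μ : ℝ) {q : TorusSite 2 L}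
    (hq : torusBand L q = μ) :
    2 * Real.log 2 ≤ 2 * Real.log (partitionFn β (hubbardTorusWith 2 L 1 0 μ)).re -
      Real.log (partitionFn (2 * β) (hubbardTorusWith 2 L 1 0 μ)).re := by
  rw [log_partitionFn_free L hL, log_partitionFn_free L hL]
  have hcard : (Fintype.card (TorusSite 2 L) : ℝ) = (L : ℝ) ^ 2 := by
    rw [card_torusSite_two]; push_cast; ring
  -- rewrite as a sum of non-negative terms
  set A : ℝ := 2 * (L : ℝ) ^ 2 * Real.log 2 with hA
  set S₁ : ℝ := ∑ k : TorusSite 2 L, (-(β * (torusBand L k - μ)) + Real.log ((1 + Real.cosh (β * (torusBand L k - μ))) / 2))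
    with hS₁
  set S₂ : ℝ := ∑ k : TorusSite 2 L, (-(2 * β * (torusBand L k - μ)) + Real.log ((1 + Real.cosh (2 * β * (torusBand L k - μ))) / 2))
    with hS₂
  have hconst : ∑ _k : TorusSite 2 L, (2 * Real.log 2) = A := by
    rw [Finset.sum_const, nsmul_eq_mul, Finset.card_univ, hcard, hA]; ring
  have key : 2 * (A + S₁) - (A + S₂) =
      ∑ k : TorusSite 2 L, (2 * Real.log ((1 + Real.cosh (β * (torusBand L k - μ))) / 2) + 2 * Real.log 2 -
        Real.log ((1 + Real.cosh (2 * (β * (torusBand L k - μ)))) / 2)) := by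
    have e1 : 2 * (A + S₁) - (A + S₂) = A + (2 * S₁ - S₂) := by ring
    rw [e1, ← hconst, hS₁, hS₂, Finset.mul_sum, ← Finset.sum_sub_distrib, ← Finset.sum_add_distrib]
    refine Finset.sum_congr rfl fun k _ => ?_
    rw [show 2 * β * (torusBand L k - μ) = 2 * (β * (torusBand L k - μ)) by ring]
    ring
  rw [key]
  have hterm : ∀ k : TorusSite 2 L, 0 ≤ 2 * Real.log ((1 + Real.cosh (β * (torusBand L k - μ))) / 2) + 2 * Real.log 2 -
      Real.log ((1 + Real.cosh (2 * (β * (torusBand L k - μ)))) / 2) := fun k => by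
    have := bdgF_two_mul_le (β * (torusBand L k - μ)); linarith
  have hq' : 2 * Real.log ((1 + Real.cosh (β * (torusBand L q - μ))) / 2) + 2 * Real.log 2 - Real.log ((1 + Real.cosh (2 * (β * (torusBand L q - μ)))) / 2) =
      2 * Real.log 2 := by
    rw [hq, sub_self, mul_zero, mul_zero, bdgF_zero]; ring
  calc 2 * Real.log 2 = 2 * Real.log ((1 + Real.cosh (β * (torusBand L q - μ))) / 2) + 2 * Real.log 2 -
      Real.log ((1 + Real.cosh (2 * (β * (torusBand L q - μ)))) / 2) := hq'.symm
    _ ≤ _ := Finset.single_le_sum (f := fun k => 2 * Real.log ((1 + Real.cosh (β * (torusBand L k - μ))) / 2) + 2 * Real.log 2 -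
        Real.log ((1 + Real.cosh (2 * (β * (torusBand L k - μ)))) / 2)) (fun k _ => hterm k) (Finset.mem_univ q)

/-- `|log Z(β, H_U) − log Z(β, H_0)| ≤ β |U| L²` for the unsourced torus (`β ≥ 0`). -/
theorem abs_log_partitionFn_interacting_sub_free_le (U μ : ℝ) {β : ℝ} (hβ : 0 ≤ β) :
    |Real.log (partitionFn β (hubbardTorusWith 2 L 1 U μ)).re -
        Real.log (partitionFn β (hubbardTorusWith 2 L 1 0 μ)).re| ≤ β * (|U| * (L : ℝ) ^ 2) := by
  have key := abs_log_partitionFn_sub_log_partitionFn_le (Literature.MathematicalPhysics.QuantumLattice.isHermitian_hubbardTorusWith L 1 U μ)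
    (Literature.MathematicalPhysics.QuantumLattice.isHermitian_hubbardTorusWith L 1 0 μ) hβ
  refine key.trans ?_
  gcongr
  have h := Summit.HubbardSuperconductivity.HubbardSuperconductivity.Theorems.norm_dWaveSourceTorus_sub_free_le L U μ 0
  rwa [dWaveSourceTorus_zero, dWaveSourceTorus_zero] at h

/-- **Entropy of the interacting torus with a level: `S_L(β) ≥ 2 log 2 − 4β|U|L²`** (`L ≥ 3`,
`β > 0`): dyadic sandwich `S(β) ≥ 2 log Z(β) − log Z(2β)` + free formula + `‖U W‖ ≤ |U|L²`. -/
theorem entropy_lower_bound_of_level (hL : 3 ≤ L) {β : ℝ} (hβ : 0 < β) {μ : ℝ} {q : TorusSite 2 L}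
    (hq : torusBand L q = μ) (U : ℝ) :
    2 * Real.log 2 - 4 * β * (|U| * (L : ℝ) ^ 2) ≤ gibbsEntropy β (hubbardTorusWith 2 L 1 U μ) := by
  have hH := Literature.MathematicalPhysics.QuantumLattice.isHermitian_hubbardTorusWith L 1 U μ
  have hsand := hH.two_mul_log_partitionFn_half_sub_le_gibbsEntropy_half (β := 2 * β) (by positivity)
  rw [show 2 * β / 2 = β by ring] at hsand
  have h1 := abs_log_partitionFn_interacting_sub_free_le L U μ hβ.le
  have h2 := abs_log_partitionFn_interacting_sub_free_le L U μ (β := 2 * β) (by positivity)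
  have hfree := two_log_two_le_dyadic_free L hL β μ hq
  rw [abs_le] at h1 h2
  linarith [h1.1, h2.2]

/-- **The entropy contradiction on one torus carrying the level `−1`.** -/
theorem no_entropy_bound_on_torus_with_level (hL3 : 3 ≤ L) (q : TorusSite 2 L)
    (hq : torusBand L q = -1) {U₀ a C : ℝ} (hU₀ : 0 < U₀) (ha : 0 < a) (hC : 0 < C)
    (hmain : ∀ U : ℝ, 0 < U → U ≤ U₀ → ∀ β : ℝ, 1 ≤ β → β ≤ Real.exp (a / U) →
      gibbsEntropy β (hubbardTorusWith 2 L 1 U (-1)) ≤ C * (L : ℝ) ^ 2 / β) :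
    False := by
  have hLpos : (0 : ℝ) < (L : ℝ) := by exact_mod_cast Nat.pos_of_ne_zero (NeZero.ne L)
  set M : ℝ := (L : ℝ) ^ 2 with hM
  have hMpos : 0 < M := by positivity
  set β : ℝ := 2 * C * M + 2 with hβdef
  have hCM : 0 < C * M := by positivity
  have hβ1 : 1 ≤ β := by linarith
  have hβpos : 0 < β := by linarith
  have hlog0 : 0 ≤ Real.log β := Real.log_nonneg hβ1
  have hl2 := Real.log_two_gt_d9
  set U : ℝ := min U₀ (min (a / (1 + Real.log β)) (Real.log 2 / (4 * β * M))) with hUdef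
  have hUpos : 0 < U := lt_min hU₀ (lt_min (div_pos ha (by linarith)) (by positivity))
  have hUU₀ : U ≤ U₀ := min_le_left _ _
  have hUa : U ≤ a / (1 + Real.log β) := (min_le_right _ _).trans (min_le_left _ _)
  have hUq : U ≤ Real.log 2 / (4 * β * M) := (min_le_right _ _).trans (min_le_right _ _)
  have hβexp : β ≤ Real.exp (a / U) := le_exp_div_of_le hUpos hβ1 hUa
  have hup := hmain U hUpos hUU₀ β hβ1 hβexp
  have hlow := entropy_lower_bound_of_level L hL3 hβpos hq U
  rw [abs_of_pos hUpos] at hlow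
  have h4 : 4 * β * (U * M) ≤ Real.log 2 := by
    calc 4 * β * (U * M) ≤ 4 * β * (Real.log 2 / (4 * β * M) * M) := by gcongr
      _ = Real.log 2 := by field_simp
  have hrhs : C * M / β < 1 / 2 := by
    rw [div_lt_iff₀ hβpos, hβdef]; nlinarith
  linarith

/-- **TARGET `stub_entropyDensity`: no finite-size threshold uniform in `β`.**
(uniform-threshold variant refuted) — witness `μ₁ = μ₂ = −1`, `L = 3·max(L₀,1)`, `β = 2CL² + 2`,
`U = min(U₀, a/(1+log β), log 2/(4βL²))`: the exact zero mode keeps `S_L(β) ≥ log 2 > CL²/β`.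
MESSAGE: `L₀(β, −1)² ≳ β/C` — the entropy-density law `s ≤ C T` is a statement about `L ≫ √(β/C)`. -/
theorem stub_entropyDensity_false_uniformL0 : ¬ (∀ μ₁ μ₂ : ℝ, -4 < μ₁ → μ₁ ≤ μ₂ → μ₂ < 0 → ∃ U₀ a C : ℝ, 0 < U₀ ∧ 0 < a ∧ 0 < C ∧ ∃ L₀ : ℕ,
    ∀ U : ℝ, 0 < U →
    U ≤ U₀ → ∀ β : ℝ, 1 ≤ β → β ≤ Real.exp (a / U) → ∀ μ ∈ Set.Icc μ₁ μ₂, 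
      ∀ (L : ℕ) [NeZero L], L₀ ≤ L → 
        Real.log (Matrix.partitionFn β (hubbardTorusWith 2 L 1 U μ)).re +
          β * (Matrix.gibbsState β (hubbardTorusWith 2 L 1 U μ) (hubbardTorusWith 2 L 1 U μ)).re ≤
          C * (L : ℝ) ^ 2 / β) := by
  intro H
  obtain ⟨U₀, a, C, hU₀, ha, hC, L₀, hmain⟩ := H (-1) (-1) (by norm_num) le_rfl (by norm_num)
  set j : ℕ := max L₀ 1 with hjdef
  have hj : 1 ≤ j := le_max_right _ _
  have hjL : L₀ ≤ j := le_max_left _ _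
  haveI : NeZero (3 * j) := ⟨by omega⟩
  have hL3 : 3 ≤ 3 * j := by omega
  have hL₀ : L₀ ≤ 3 * j := by omega
  exact no_entropy_bound_on_torus_with_level (3 * j) hL3 ((![((j : ℕ) : ZMod (3 * j)), 0] : TorusSite 2 (3 * j))) (torusBand_qOn hj) hU₀ ha hC
    (fun U hU hUU β hβ hβa => hmain U hU hUU β hβ hβa (-1) ⟨le_rfl, le_rfl⟩ (3 * j) hL₀)

/-- Corollary: the `∀ L ≥ 3` variant of `stub_entropyDensity` is false. -/
theorem stub_entropyDensity_false_allL : ¬ (∀ μ₁ μ₂ : ℝ, -4 < μ₁ → μ₁ ≤ μ₂ → μ₂ < 0 → ∃ U₀ a C : ℝ, 0 < U₀ ∧ 0 < a ∧ 0 < C ∧ 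
    ∀ U : ℝ, 0 < U →
    U ≤ U₀ → ∀ β : ℝ, 1 ≤ β → β ≤ Real.exp (a / U) → ∀ μ ∈ Set.Icc μ₁ μ₂, 
      ∀ (L : ℕ) [NeZero L], 3 ≤ L → 
        Real.log (Matrix.partitionFn β (hubbardTorusWith 2 L 1 U μ)).re +
          β * (Matrix.gibbsState β (hubbardTorusWith 2 L 1 U μ) (hubbardTorusWith 2 L 1 U μ)).re ≤
          C * (L : ℝ) ^ 2 / β) :=
  fun H => stub_entropyDensity_false_uniformL0 (stubEntropyDensityUniformL0_of_allL H)

end Targets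

end Summit.HubbardSuperconductivity.HubbardSuperconductivity.Theorems.TwSourcedInertness.Negative
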